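import Summits.MatrixMultiplication.MatrixMultiplication.Theorems.FarEdgeDescentLineAntichain
import HarnessLib

/-!
# Pencil Gram invariants of the BCZ line, IV: the full characteristic form — every field

Route `FarEdgeDescent` (cell `decomp-mm`, lens 2 «structural dichotomy (special vs generic)»,
gen 40), Kernel XV-a; support for the aside `SubLogRate` (stmt-MatrixMultiplication-25371).

Parts I–II (`FarEdgeDescentPencilGram`, `FarEdgeDescentLineAntichain`) closed the last arrows
`𝔖(q) → 𝔖(0)` of the closed BCZ line with the first TWO coefficients of the Segre characteristic
form of the quadric pair `(det X, det_q X) ∘ Bᵀ` — `det S_q = q² det S_1` (I1) and the polarised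
discriminant `tr(adj S_1·S_q) = (2+2q) det S_1` (I2) — and therefore only in characteristic
`≠ 2`: the trailing value of (I2) is `2κ₁³κ₂ det Ĵ_1`.

This part computes the WHOLE characteristic form, for every `B` over every commutative ring
(singular `B` included, which is what lets it survive the degeneration substitution
`B ∈ K[ε]^{4×4}`):

* `det_smul_gram_add_smul_gram` **(I∞)**:
  `det(a·S_p + b·S_q) = (det B)²·det Ĵ_1·(a+b)²(ap+bq)²` — the pencil `⟨S_1, S_q⟩` has Segre
  symbol `[(11)(11)]` with roots `t = -1, -1/q` (`a·Ĵ_p + b·Ĵ_q = Ĵ_1·diag(a d_p + b d_q)`);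
  (I1) and (I2) are its extreme and sub-extreme coefficients, and the normalised forms
  `det(S_1 + t S_q) = (1+t)²(1+qt)² det S_1` (`det_gram_add_smul_gram`),
  `q² det(t S_1 + S_q) = (t+1)²(t+q)² det S_q` (`mul_det_smul_gram_add_gram`) hold for EVERY
  `t ∈ R`;
* the **substitution `t = ±ε^{|a₁-a₂|}`** (no new indeterminate, no coefficient extraction):
  if `S_1 = ε^{a₁}S₁`, `S_q = ε^{a₂}S₂` with `a₂ < a₁`, then `S_1 ± ε^{a₁-a₂}S_q = ε^{a₁}(S₁ ± S₂)`
  and (I∞) evaluated at `ε = 0` gives `det(S₁(0) ± S₂(0)) = det S₁(0)`; with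
  `S₁(0) = κ₁Ĵ_1`, `S₂(0) = κ₂Ĵ_0` this reads `(κ₁ ± κ₂)²κ₁² det Ĵ_1 = κ₁⁴ det Ĵ_1`, i.e.
  `(κ₁ + κ₂)² = κ₁² = (κ₁ - κ₂)²`, whence `2κ₂² = 0` and — in characteristic `2` directly
  `κ₂² = 0` — `κ₂ = 0` (`sq_add_sq_sub_elim`): NO factor `2` is ever divided by;
* `pencil_caseA`, `pencil_caseB`: the **pencil lemma over EVERY field** — the order comparison
  of Part II with (M1)/(M2) in place of the polarised discriminant; Part V
  (`FarEdgeDescentLineAllChar`) assembles `𝔖(q) ⋭ 𝔖(0)` and the closed-line package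
  without the hypothesis `(2 : K) ≠ 0`, Part VI (`FarEdgeDescentCorankOneClasses`) transports
  it to the tensors and to all eight single deletions of `⟨2,2,2⟩`.

Lens reading (special vs generic): the finite level of the dichotomy on the closed support class of
`⟨2,2,2⟩` becomes field-independent — generic `𝔖(q) ≅ 𝔖(q⁻¹)`, coherent `𝔖(1) ≅ ⟨2,2,2⟩` and the
special corank-one member `𝔖(0)` are pairwise `⊴`-incomparable over every field.

References: W. V. D. Hodge, D. Pedoe, *Methods of Algebraic Geometry* II (1952, repr. 1994),
Book IV, Ch. XIII §10–11 (pairs of quadrics, Segre symbols) [HodgePedoe1994]; P. Bürgisser, M. Clausen,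
M. A. Shokrollahi, *Algebraic Complexity Theory* (1997), (15.19), (15.25), §20.2
[BurgisserClausenShokrollahi1997]; M. Bläser, M. Christandl, J. Zuiddam, arXiv:1705.09652, §2,
Lemma 3 [BlaserChristandlZuiddam2017].
-/

noncomputable section

open scoped BigOperators Polynomial Matrix

set_option linter.dupNamespace false

namespace Summit.MatrixMultiplication.MatrixMultiplication.Theorems.FarEdgeDescentPencilCharForm

open Literature.Computability.AlgebraicComplexity
open Summit.MatrixMultiplication.MatrixMultiplication.Theorems.FarEdgeDescentSignTwistDet
open Summit.MatrixMultiplication.MatrixMultiplication.Theorems.FarEdgeDescentWeightFamily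
  (famW fam fam_one)
open Summit.MatrixMultiplication.MatrixMultiplication.Theorems.FarEdgeDescentWeightFamilyDet
open Summit.MatrixMultiplication.MatrixMultiplication.Theorems.FarEdgeDescentLineDetPair
open Summit.MatrixMultiplication.MatrixMultiplication.Theorems.FarEdgeDescentLineRigidity
  (trailing_identity trailing_isHomogeneous fam_zero_not_algDegeneratesTo_fam)
open Summit.MatrixMultiplication.MatrixMultiplication.Theorems.FarEdgeDescentPencilGram
open Summit.MatrixMultiplication.MatrixMultiplication.Theorems.FarEdgeDescentStratumSymmetries
  (fam_restrictsTo_fam_inv)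
open Summit.MatrixMultiplication.MatrixMultiplication.Theorems.FarEdgeDescentLineAntichain
  (eval_zero_of_X_pow_mul_eq_of_le card_Idx det_Jh_one_ne_zero eval_det)

universe u

/-! ## (I∞) The full characteristic form of the pencil, every commutative ring -/

section CharForm
variable (R : Type*) [CommRing R]

/-- `∏_b (a·d_p + b·d_q)_b = (a+b)²(ap+bq)²`. [folklore] -/
theorem prod_smul_dq_add_smul_dq (a b p q : R) :
    ∏ x, (a • dq R p + b • dq R q) x = (a + b) ^ 2 * (a * p + b * q) ^ 2 := by
  simp [Fintype.prod_prod_type, Fin.prod_univ_two, dq]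
  ring

/-- `a·Ĵ_p + b·Ĵ_q = Ĵ_1 · diag(a d_p + b d_q)`. [folklore] -/
theorem smul_Jh_add_smul_Jh (a b p q : R) :
    a • Jh R p + b • Jh R q = Jh R 1 * Matrix.diagonal (a • dq R p + b • dq R q) := by
  rw [Jh_eq_mul_diagonal R p, Jh_eq_mul_diagonal R q, ← Matrix.mul_smul, ← Matrix.mul_smul,
    ← Matrix.mul_add, ← Matrix.diagonal_smul, ← Matrix.diagonal_smul, Matrix.diagonal_add]
  rfl

/-- `det(a·Ĵ_p + b·Ĵ_q) = det Ĵ_1 · (a+b)²(ap+bq)²`. [cite: HodgePedoe1994, Bk IV Ch. XIII §10] -/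
theorem det_smul_Jh_add_smul_Jh (a b p q : R) :
    (a • Jh R p + b • Jh R q).det = (Jh R 1).det * ((a + b) ^ 2 * (a * p + b * q) ^ 2) := by
  rw [smul_Jh_add_smul_Jh, Matrix.det_mul, Matrix.det_diagonal, prod_smul_dq_add_smul_dq]

/-- `det(κ·Ĵ_1 + μ·Ĵ_0) = det Ĵ_1 · (κ+μ)²κ²`. [cite: HodgePedoe1994, Bk IV Ch. XIII §10] -/
theorem det_smul_Jh_one_add_smul_Jh_zero (κ μ : R) :
    (κ • Jh R 1 + μ • Jh R 0).det = (Jh R 1).det * ((κ + μ) ^ 2 * κ ^ 2) := by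
  rw [det_smul_Jh_add_smul_Jh]
  ring

/-- `det(κ·Ĵ_1 - μ·Ĵ_0) = det Ĵ_1 · (κ-μ)²κ²`. [cite: HodgePedoe1994, Bk IV Ch. XIII §10] -/
theorem det_smul_Jh_one_sub_smul_Jh_zero (κ μ : R) :
    (κ • Jh R 1 - μ • Jh R 0).det = (Jh R 1).det * ((κ - μ) ^ 2 * κ ^ 2) := by
  rw [sub_eq_add_neg, ← neg_smul, det_smul_Jh_add_smul_Jh]
  ring

variable {R} (B : Matrix Idx Idx R)

/-- `a·S_p + b·S_q = B (a·Ĵ_p + b·Ĵ_q) Bᵀ`. [folklore] -/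
theorem smul_gram_add_smul_gram (a b p q : R) :
    a • gram B p + b • gram B q = B * (a • Jh R p + b • Jh R q) * Bᵀ := by
  simp only [gram, Matrix.mul_add, Matrix.add_mul, Matrix.mul_smul, Matrix.smul_mul]

/-- **(I∞) The characteristic form of the pencil**:
`det(a·S_p + b·S_q) = (det B)² · det Ĵ_1 · (a+b)²(ap+bq)²` for EVERY `B` (singular included)
over every commutative ring — Segre symbol `[(11)(11)]`.
[cite: HodgePedoe1994, Bk IV Ch. XIII §10–11] -/
theorem det_smul_gram_add_smul_gram (a b p q : R) :
    (a • gram B p + b • gram B q).det =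
      B.det ^ 2 * (Jh R 1).det * ((a + b) ^ 2 * (a * p + b * q) ^ 2) := by
  rw [smul_gram_add_smul_gram, Matrix.det_mul, Matrix.det_mul, Matrix.det_transpose,
    det_smul_Jh_add_smul_Jh]
  ring

/-- **(M1)** `det(S_1 + t·S_q) = (1+t)²(1+qt)² · det S_1`, every `t ∈ R`.
[cite: HodgePedoe1994, Bk IV Ch. XIII §10] -/
theorem det_gram_add_smul_gram (t q : R) :
    (gram B 1 + t • gram B q).det = (1 + t) ^ 2 * (1 + q * t) ^ 2 * (gram B 1).det := by
  have h := det_smul_gram_add_smul_gram B 1 t 1 q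
  rw [one_smul] at h
  rw [h, det_gram]
  ring

/-- **(M2)** `q² · det(t·S_1 + S_q) = (t+1)²(t+q)² · det S_q`, every `t ∈ R`.
[cite: HodgePedoe1994, Bk IV Ch. XIII §10] -/
theorem mul_det_smul_gram_add_gram (t q : R) :
    q ^ 2 * (t • gram B 1 + gram B q).det = (t + 1) ^ 2 * (t + q) ^ 2 * (gram B q).det := by
  have h := det_smul_gram_add_smul_gram B t 1 1 q
  rw [one_smul] at h
  rw [h, det_gram]
  ring

/-- (I1) is (I∞) at `(a, b) = (0, 1)` against `(1, 0)`: `det S_q = q² det S_1` — recovered.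
[folklore] -/
theorem det_gram_eq' (q : R) : (gram B q).det = q ^ 2 * (gram B 1).det := by
  have h := det_smul_gram_add_smul_gram B 0 1 1 q
  have h' := det_smul_gram_add_smul_gram B 1 0 1 q
  rw [zero_smul, zero_add, one_smul] at h
  rw [one_smul, zero_smul, add_zero] at h'
  rw [h, h']
  ring

end CharForm

/-! ## Evaluation at `ε = 0` and the `2`-free endgame -/

section Orders
variable {K : Type u} [Field K]

/-- `(det (S + T))(0) = det (S(0) + T(0))`. [folklore] -/
theorem eval_det_add (S T : Matrix Idx Idx K[X]) :
    (S + T).det.eval 0 = (S.map (Polynomial.eval 0) + T.map (Polynomial.eval 0)).det := by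
  rw [← Polynomial.coe_evalRingHom, RingHom.map_det, map_add, RingHom.mapMatrix_apply,
    RingHom.mapMatrix_apply]

/-- `(det (S - T))(0) = det (S(0) - T(0))`. [folklore] -/
theorem eval_det_sub (S T : Matrix Idx Idx K[X]) :
    (S - T).det.eval 0 = (S.map (Polynomial.eval 0) - T.map (Polynomial.eval 0)).det := by
  rw [← Polynomial.coe_evalRingHom, RingHom.map_det, map_sub, RingHom.mapMatrix_apply,
    RingHom.mapMatrix_apply]

/-- **Order extraction**: `det(ε^a·M) = u · det(ε^a·N)` in `K[ε]` gives
`det M(0) = u(0) · det N(0)`. [folklore] -/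
theorem eval_det_eq_of_smul {M N : Matrix Idx Idx K[X]} {a : ℕ} {u : K[X]}
    (h : ((Polynomial.X : K[X]) ^ a • M).det = u * ((Polynomial.X : K[X]) ^ a • N).det) :
    M.det.eval 0 = u.eval 0 * N.det.eval 0 := by
  rw [Matrix.det_smul, Matrix.det_smul, card_Idx, mul_left_comm] at h
  have h' : M.det = u * N.det :=
    mul_left_cancel₀ (pow_ne_zero _ (pow_ne_zero _ Polynomial.X_ne_zero)) h
  rw [h', Polynomial.eval_mul]

/-- **The `2`-free endgame**: `(κ₁+κ₂)² = κ₁² = (κ₁-κ₂)²` forces `κ₂ = 0` in EVERY characteristic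
(`2κ₂² = 0`; and if `2 = 0` then already `κ₂² = (κ₁+κ₂)² - κ₁² - κ₁κ₂·2 = 0`). [folklore] -/
theorem sq_add_sq_sub_elim {κ₁ κ₂ : K} (hκ₂ : κ₂ ≠ 0) (hp : (κ₁ + κ₂) ^ 2 = κ₁ ^ 2)
    (hm : (κ₁ - κ₂) ^ 2 = κ₁ ^ 2) : False := by
  have h2 : (2 : K) * κ₂ ^ 2 = 0 := by linear_combination hp + hm
  rcases mul_eq_zero.mp h2 with h | h
  · have h' : κ₂ ^ 2 = 0 := by linear_combination hp - κ₁ * κ₂ * h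
    exact pow_ne_zero 2 hκ₂ h'
  · exact pow_ne_zero 2 hκ₂ h

/-- `((1 + t)² (1 + q t)²)(0) = 1` for `t = ±ε^d`, `d ≠ 0`. [folklore] -/
theorem eval_unit_M1 (q : K) {t : K[X]} (ht : t.eval 0 = 0) :
    ((1 + t) ^ 2 * (1 + Polynomial.C q * t) ^ 2).eval 0 = 1 := by
  simp [ht]

/-- `((t + 1)² (t + q)²)(0) = q²` for `t = ±ε^d`, `d ≠ 0`. [folklore] -/
theorem eval_unit_M2 (q : K) {t : K[X]} (ht : t.eval 0 = 0) :
    ((t + 1) ^ 2 * (t + Polynomial.C q) ^ 2).eval 0 = q ^ 2 := by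
  simp [ht]

end Orders

/-! ## The pencil lemma over every field -/

section PencilLemma
variable {K : Type u} [Field K]

/-- **Pencil lemma, case A** (`u - v` carries `det X`, `u - q v` carries `x₀₀x₁₁`): impossible for
`q ≠ 0` over EVERY field.  `a₂ ≥ a₁` contradicts (I1); `a₂ < a₁` contradicts (M1) at
`t = ±ε^{a₁-a₂}`: `(κ₁ ± κ₂)² = κ₁²`. [cite: BurgisserClausenShokrollahi1997, (15.19)]
[cite: HodgePedoe1994, Bk IV Ch. XIII §10] -/
theorem pencil_caseA {q κ₁ κ₂ : K} (hq : q ≠ 0) (hκ₁ : κ₁ ≠ 0) (hκ₂ : κ₂ ≠ 0)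
    {B S₁ S₂ : Matrix Idx Idx K[X]} {a₁ a₂ : ℕ}
    (h₁ : gram B 1 = (Polynomial.X : K[X]) ^ a₁ • S₁)
    (h₁0 : S₁.map (Polynomial.eval 0) = κ₁ • Jh K 1)
    (h₂ : gram B (Polynomial.C q) = (Polynomial.X : K[X]) ^ a₂ • S₂)
    (h₂0 : S₂.map (Polynomial.eval 0) = κ₂ • Jh K 0) : False := by
  have hJ := det_Jh_one_ne_zero (K := K)
  have ev₁ : S₁.det.eval 0 = κ₁ ^ 4 * (Jh K 1).det := by
    rw [FarEdgeDescentLineAntichain.eval_det, h₁0, Matrix.det_smul, card_Idx]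
  have ev₂ : S₂.det.eval 0 = 0 := by
    rw [FarEdgeDescentLineAntichain.eval_det, h₂0, Matrix.det_smul, det_Jh_zero, mul_zero]
  rcases (Nat.lt_or_ge a₂ a₁).symm with hle | hlt
  · have hI := det_gram_eq B (Polynomial.C q)
    rw [h₁, h₂, Matrix.det_smul, Matrix.det_smul, card_Idx, ← pow_mul, ← pow_mul] at hI
    have hI' : (Polynomial.X : K[X]) ^ (a₁ * 4) * (Polynomial.C q ^ 2 * S₁.det) =
        Polynomial.X ^ (a₂ * 4) * S₂.det := by
      rw [hI]
      ring
    have h0 := eval_zero_of_X_pow_mul_eq_of_le (by omega) hI' ev₂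
    rw [Polynomial.eval_mul, Polynomial.eval_pow, Polynomial.eval_C, ev₁] at h0
    exact mul_ne_zero (pow_ne_zero _ hq) (mul_ne_zero (pow_ne_zero _ hκ₁) hJ) h0
  · obtain ⟨d, rfl⟩ := Nat.exists_eq_add_of_le hlt.le
    have hd : d ≠ 0 := by omega
    have ht : ((Polynomial.X : K[X]) ^ d).eval 0 = 0 := by
      rw [Polynomial.eval_pow, Polynomial.eval_X, zero_pow hd]
    have ht' : (-(Polynomial.X : K[X]) ^ d).eval 0 = 0 := by
      rw [Polynomial.eval_neg, ht, neg_zero]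
    -- `S_1 + ε^d S_q = ε^{a₁}(S₁ + S₂)`, `S_1 - ε^d S_q = ε^{a₁}(S₁ - S₂)`
    have kp : gram B 1 + (Polynomial.X : K[X]) ^ d • gram B (Polynomial.C q) =
        (Polynomial.X : K[X]) ^ (a₂ + d) • (S₁ + S₂) := by
      rw [h₁, h₂, smul_smul, ← pow_add, add_comm d a₂, smul_add]
    have km : gram B 1 + (-(Polynomial.X : K[X]) ^ d) • gram B (Polynomial.C q) =
        (Polynomial.X : K[X]) ^ (a₂ + d) • (S₁ - S₂) := by
      rw [neg_smul, h₁, h₂, smul_smul, ← pow_add, add_comm d a₂, smul_sub, sub_eq_add_neg]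
    have dp := det_gram_add_smul_gram B ((Polynomial.X : K[X]) ^ d) (Polynomial.C q)
    have dm := det_gram_add_smul_gram B (-(Polynomial.X : K[X]) ^ d) (Polynomial.C q)
    rw [kp, h₁] at dp
    rw [km, h₁] at dm
    have ep := eval_det_eq_of_smul dp
    have em := eval_det_eq_of_smul dm
    rw [eval_unit_M1 q ht, one_mul, eval_det_add, h₁0, h₂0, ev₁,
      det_smul_Jh_one_add_smul_Jh_zero] at ep
    rw [eval_unit_M1 q ht', one_mul, eval_det_sub, h₁0, h₂0, ev₁,
      det_smul_Jh_one_sub_smul_Jh_zero] at em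
    have u0 : (Jh K 1).det * κ₁ ^ 2 ≠ 0 := mul_ne_zero hJ (pow_ne_zero _ hκ₁)
    have hp : (κ₁ + κ₂) ^ 2 = κ₁ ^ 2 :=
      mul_left_cancel₀ u0 (by linear_combination ep)
    have hm : (κ₁ - κ₂) ^ 2 = κ₁ ^ 2 :=
      mul_left_cancel₀ u0 (by linear_combination em)
    exact sq_add_sq_sub_elim hκ₂ hp hm

set_option maxHeartbeats 400000 in
/-- **Pencil lemma, case B** (`u - v` carries `x₀₀x₁₁`, `u - q v` carries `det X`): impossible for
`q ≠ 0` over EVERY field.  `a₂ ≤ a₁` contradicts (I1); `a₂ > a₁` contradicts (M2) at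
`t = ±ε^{a₂-a₁}`: `(κ₂ ± κ₁)² = κ₂²`. [cite: BurgisserClausenShokrollahi1997, (15.19)]
[cite: HodgePedoe1994, Bk IV Ch. XIII §10] -/
theorem pencil_caseB {q κ₁ κ₂ : K} (hq : q ≠ 0) (hκ₁ : κ₁ ≠ 0) (hκ₂ : κ₂ ≠ 0)
    {B S₁ S₂ : Matrix Idx Idx K[X]} {a₁ a₂ : ℕ}
    (h₁ : gram B 1 = (Polynomial.X : K[X]) ^ a₁ • S₁)
    (h₁0 : S₁.map (Polynomial.eval 0) = κ₁ • Jh K 0)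
    (h₂ : gram B (Polynomial.C q) = (Polynomial.X : K[X]) ^ a₂ • S₂)
    (h₂0 : S₂.map (Polynomial.eval 0) = κ₂ • Jh K 1) : False := by
  have hJ := det_Jh_one_ne_zero (K := K)
  have ev₁ : S₁.det.eval 0 = 0 := by
    rw [FarEdgeDescentLineAntichain.eval_det, h₁0, Matrix.det_smul, det_Jh_zero, mul_zero]
  have ev₂ : S₂.det.eval 0 = κ₂ ^ 4 * (Jh K 1).det := by
    rw [FarEdgeDescentLineAntichain.eval_det, h₂0, Matrix.det_smul, card_Idx]
  rcases (Nat.lt_or_ge a₁ a₂).symm with hle | hlt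
  · have hI := det_gram_eq B (Polynomial.C q)
    rw [h₁, h₂, Matrix.det_smul, Matrix.det_smul, card_Idx, ← pow_mul, ← pow_mul] at hI
    have hI' : (Polynomial.X : K[X]) ^ (a₂ * 4) * S₂.det =
        Polynomial.X ^ (a₁ * 4) * (Polynomial.C q ^ 2 * S₁.det) := by
      rw [hI]
      ring
    have hg : (Polynomial.C q ^ 2 * S₁.det).eval 0 = 0 := by
      rw [Polynomial.eval_mul, ev₁, mul_zero]
    have h0 := eval_zero_of_X_pow_mul_eq_of_le (by omega) hI' hg
    rw [ev₂] at h0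
    exact mul_ne_zero (pow_ne_zero _ hκ₂) hJ h0
  · obtain ⟨d, rfl⟩ := Nat.exists_eq_add_of_le hlt.le
    have hd : d ≠ 0 := by omega
    have ht : ((Polynomial.X : K[X]) ^ d).eval 0 = 0 := by
      rw [Polynomial.eval_pow, Polynomial.eval_X, zero_pow hd]
    have ht' : (-(Polynomial.X : K[X]) ^ d).eval 0 = 0 := by
      rw [Polynomial.eval_neg, ht, neg_zero]
    -- `ε^d S_1 + S_q = ε^{a₂}(S₂ + S₁)`, `-ε^d S_1 + S_q = ε^{a₂}(S₂ - S₁)`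
    have kp : (Polynomial.X : K[X]) ^ d • gram B 1 + gram B (Polynomial.C q) =
        (Polynomial.X : K[X]) ^ (a₁ + d) • (S₂ + S₁) := by
      rw [h₁, h₂, smul_smul, ← pow_add, add_comm d a₁, smul_add, add_comm]
    have km : (-(Polynomial.X : K[X]) ^ d) • gram B 1 + gram B (Polynomial.C q) =
        (Polynomial.X : K[X]) ^ (a₁ + d) • (S₂ - S₁) := by
      rw [neg_smul, h₁, h₂, smul_smul, ← pow_add, add_comm d a₁, smul_sub, sub_eq_add_neg,
        add_comm]
    have dp := mul_det_smul_gram_add_gram B ((Polynomial.X : K[X]) ^ d) (Polynomial.C q)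
    have dm := mul_det_smul_gram_add_gram B (-(Polynomial.X : K[X]) ^ d) (Polynomial.C q)
    rw [kp, h₂, Matrix.det_smul, Matrix.det_smul, card_Idx] at dp
    rw [km, h₂, Matrix.det_smul, Matrix.det_smul, card_Idx] at dm
    have dp' : (S₂ + S₁).det * Polynomial.C q ^ 2 =
        ((Polynomial.X : K[X]) ^ d + 1) ^ 2 * (Polynomial.X ^ d + Polynomial.C q) ^ 2 * S₂.det :=
      mul_left_cancel₀ (pow_ne_zero 4 (pow_ne_zero (a₁ + d) Polynomial.X_ne_zero))
        (by linear_combination dp)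
    have dm' : (S₂ - S₁).det * Polynomial.C q ^ 2 =
        (-(Polynomial.X : K[X]) ^ d + 1) ^ 2 * (-Polynomial.X ^ d + Polynomial.C q) ^ 2 *
          S₂.det :=
      mul_left_cancel₀ (pow_ne_zero 4 (pow_ne_zero (a₁ + d) Polynomial.X_ne_zero))
        (by linear_combination dm)
    have ep := congrArg (Polynomial.eval 0) dp'
    have em := congrArg (Polynomial.eval 0) dm'
    rw [Polynomial.eval_mul, Polynomial.eval_mul, eval_unit_M2 q ht, Polynomial.eval_pow,
      Polynomial.eval_C, eval_det_add, h₁0, h₂0, ev₂, det_smul_Jh_one_add_smul_Jh_zero] at ep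
    rw [Polynomial.eval_mul, Polynomial.eval_mul, eval_unit_M2 q ht', Polynomial.eval_pow,
      Polynomial.eval_C, eval_det_sub, h₁0, h₂0, ev₂, det_smul_Jh_one_sub_smul_Jh_zero] at em
    have u0 : (Jh K 1).det * κ₂ ^ 2 * q ^ 2 ≠ 0 :=
      mul_ne_zero (mul_ne_zero hJ (pow_ne_zero _ hκ₂)) (pow_ne_zero _ hq)
    have hp : (κ₂ + κ₁) ^ 2 = κ₂ ^ 2 :=
      mul_left_cancel₀ u0 (by linear_combination ep)
    have hm : (κ₂ - κ₁) ^ 2 = κ₂ ^ 2 :=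
      mul_left_cancel₀ u0 (by linear_combination em)
    exact sq_add_sq_sub_elim hκ₁ hp hm

end PencilLemma

end Summit.MatrixMultiplication.MatrixMultiplication.Theorems.FarEdgeDescentPencilCharForm

end
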